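import Summits.Ventures.PercRepro.RankLevelSetHallRuleLPaving

/-!
# PercRepro — RULE L PAYS EVERY MEMBER, AND C-044's UP-HALL FORM HOLDS, FOR EVERY MATROID OF GIRTH `≥ q` AT THE TIGHT
LAYER — IN PARTICULAR FOR EVERY PAVING MATROID (p4, gen 31; paper proofs/P4-CELL-THREE.md §14.16)

`ruleL_pays_of_paving_flat` (RankLevelSetHallRuleLPaving) pays every member whose closure-flat has no circuit of fewer
than `q` elements.  When the WHOLE matroid has girth `≥ q` — every subset of `E` with at most `q − 1` elements is
independent — every member qualifies, so night-1's Rule L pays every member (`ruleLUp_of_girth`) and the UP-Hall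
condition of C-044 holds for every family of members at the tight layer `#E = p + q` (`hallUp_of_girth`, through
`hallUp_of_ncard_eq_of_ruleL`): THIS is the new content — the UP form is the open one (the DOWN form at the tight
layer is night-1's theorem for every matroid, `hall_down_of_ncard_eq`).  With `𝒜 = 𝒵` the UP form gives the rank
level-set inequality C-025 at the tight layer (`rls_tight_of_girth`: `Φ(p,q)·#{A ⊆ E : r(A) = p, r(E ∖ A) = q} ≤
#{A ⊆ E : q < r(A) < p}`, the body of `C025` / `ThmN.RLS M p q`) — recorded here as a CONSISTENCY corollary only: at the
tight layer C-025 is already night-1's Theorem M (`c025_of_ncard_eq`, RankLevelSetHallTight) for EVERY matroid, and the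
present route recovers it on the girth class through the UP side.  A PAVING matroid (every set with fewer than `r(M)`
elements independent) has girth `≥ r(M) ≥ p > q` as soon as it has a member, so the same holds for every paving — in
particular every sparse paving — matroid at every tight layer `q + 2 ≤ p` (`ruleLUp_of_paving`, `hallUp_of_paving`,
`rls_tight_of_paving`).  Axioms standard.
-/

namespace PercRepro

open Set Matroid Finset

variable {α : Type} (M : Matroid α) [M.Finite]

/-- **Rule L pays every member of a matroid of girth `≥ q`** (every subset of `E` with at most `q − 1` elements is
independent) at the tight layer, `q + 2 ≤ p`. -/
theorem ruleLUp_of_girth (p q : ℕ) (hE : M.E.ncard = p + q) (hpq : q + 2 ≤ p)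
    (hg : ∀ A ⊆ M.E, A.ncard ≤ q - 1 → M.Indep A) : RuleLUp M p q := by
  intro Z hZ
  exact ruleL_pays_of_paving_flat M p q hE hpq hZ
    (fun A hA hcard => hg A (hA.trans (M.closure_subset_ground Z)) hcard)

/-- **C-044, UP form, for every matroid of girth `≥ q`** at the tight layer: every family `𝒜` of members has at least
`Φ(p,q)·#𝒜` UP-neighbours in `Y`. -/
theorem hallUp_of_girth (p q : ℕ) (hE : M.E.ncard = p + q) (hpq : q + 2 ≤ p)
    (hg : ∀ A ⊆ M.E, A.ncard ≤ q - 1 → M.Indep A) (𝒜 : Set (Set α)) (h𝒜 : 𝒜 ⊆ cellMembers M p q) :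
    phiK p q * (𝒜.ncard : ℚ) ≤ ((upNbhd M p q 𝒜).ncard : ℚ) :=
  hallUp_of_ncard_eq_of_ruleL M p q hE (ruleLUp_of_girth M p q hE hpq hg) 𝒜 h𝒜

/-- C-025 at the tight layer for every matroid of girth `≥ q` — a CONSISTENCY corollary of the UP form with `𝒜 = 𝒵`
(`Φ(p,q)·#{A ⊆ E : r(A) = p, r(E ∖ A) = q} ≤ #{A ⊆ E : q < r(A) < p}`, the body of `C025` / `ThmN.RLS M p q`); at the
tight layer this holds for EVERY matroid by night-1's Theorem M (`c025_of_ncard_eq`, the DOWN form). -/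
theorem rls_tight_of_girth (p q : ℕ) (hE : M.E.ncard = p + q) (hpq : q + 2 ≤ p)
    (hg : ∀ A ⊆ M.E, A.ncard ≤ q - 1 → M.Indep A) :
    phiK p q * ({A : Set α | A ⊆ M.E ∧ M.eRk A = (p : ℕ∞) ∧ M.eRk (M.E \ A) = (q : ℕ∞)}.ncard : ℚ) ≤
      ({A : Set α | A ⊆ M.E ∧ (q : ℕ∞) < M.eRk A ∧ M.eRk A < (p : ℕ∞)}.ncard : ℚ) := by
  have h1 := hallUp_of_girth M p q hE hpq hg (cellMembers M p q) (subset_refl _)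
  rw [ncard_cellMembers_eq] at h1
  refine h1.trans ?_
  exact_mod_cast Set.ncard_le_ncard (upNbhd_subset_cellY _ p q) (cellY_finite M p q)

omit [M.Finite] in
/-- A PAVING matroid (every subset of `E` with fewer than `r(M)` elements is independent) has girth `≥ q` at every tight
layer that has a member: `q − 1 < q + 2 ≤ p = r(E ∖ Z) ≤ r(M)`. -/
lemma indep_of_paving_of_mem_cellMembers {p q : ℕ} (hpq : q + 2 ≤ p)
    (hpav : ∀ A ⊆ M.E, (A.ncard : ℕ∞) < M.eRank → M.Indep A) {Z : Set α} (hZ : Z ∈ cellMembers M p q)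
    {A : Set α} (hA : A ⊆ M.E) (hcard : A.ncard ≤ q - 1) : M.Indep A := by
  refine hpav A hA ?_
  have h1 : (p : ℕ∞) ≤ M.eRank := by
    rw [← hZ.2.2]
    exact M.eRk_le_eRank _
  have h2 : (A.ncard : ℕ∞) < (p : ℕ∞) := by exact_mod_cast (show A.ncard < p by omega)
  exact lt_of_lt_of_le h2 h1

/-- **Rule L pays every member of a paving matroid** at every tight layer. -/
theorem ruleLUp_of_paving (p q : ℕ) (hE : M.E.ncard = p + q) (hpq : q + 2 ≤ p)
    (hpav : ∀ A ⊆ M.E, (A.ncard : ℕ∞) < M.eRank → M.Indep A) : RuleLUp M p q := by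
  intro Z hZ
  exact ruleL_pays_of_paving_flat M p q hE hpq hZ (fun A hA hcard =>
    indep_of_paving_of_mem_cellMembers M hpq hpav hZ (hA.trans (M.closure_subset_ground Z)) hcard)

/-- **C-044, UP form, for every paving matroid** at the tight layer. -/
theorem hallUp_of_paving (p q : ℕ) (hE : M.E.ncard = p + q) (hpq : q + 2 ≤ p)
    (hpav : ∀ A ⊆ M.E, (A.ncard : ℕ∞) < M.eRank → M.Indep A) (𝒜 : Set (Set α))
    (h𝒜 : 𝒜 ⊆ cellMembers M p q) : phiK p q * (𝒜.ncard : ℚ) ≤ ((upNbhd M p q 𝒜).ncard : ℚ) :=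
  hallUp_of_ncard_eq_of_ruleL M p q hE (ruleLUp_of_paving M p q hE hpq hpav) 𝒜 h𝒜

/-- C-025 at the tight layer for every paving matroid, recovered through the UP form (a consistency corollary: Theorem M
`c025_of_ncard_eq` gives it for every matroid). -/
theorem rls_tight_of_paving (p q : ℕ) (hE : M.E.ncard = p + q) (hpq : q + 2 ≤ p)
    (hpav : ∀ A ⊆ M.E, (A.ncard : ℕ∞) < M.eRank → M.Indep A) :
    phiK p q * ({A : Set α | A ⊆ M.E ∧ M.eRk A = (p : ℕ∞) ∧ M.eRk (M.E \ A) = (q : ℕ∞)}.ncard : ℚ) ≤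
      ({A : Set α | A ⊆ M.E ∧ (q : ℕ∞) < M.eRk A ∧ M.eRk A < (p : ℕ∞)}.ncard : ℚ) := by
  have h1 := hallUp_of_paving M p q hE hpq hpav (cellMembers M p q) (subset_refl _)
  rw [ncard_cellMembers_eq] at h1
  refine h1.trans ?_
  exact_mod_cast Set.ncard_le_ncard (upNbhd_subset_cellY _ p q) (cellY_finite M p q)

end PercRepro
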